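import Summits.Ventures.Crystal3D.Theorems.StickyWulffConstantTextureBuildLayerDescent
import Summits.Ventures.Crystal3D.Theorems.StickyWulffConstantTextureBuildLayerPropagationFrame
import HarnessLib

/-!
# TB-1 brick L-PROP-4 (frame form): the descent with re-expansion FOR A LABELLED PACKING — the near-wall presentation of a grain, read from a small deep chart
# (lane T, crux `TextureLiminfV5`, stmt-Ventures-23912; memo HOME/wulff-p2/g25/SLAB-PLATES-g25.md §6 (2)–(4))

HONEST FRAMING. Venture `Summits/Ventures/Crystal3D` (cell `crystal3d-full`), route `route-Ventures-StickyWulffConstant`, helper `--supports` the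
law-v5 crux `TextureLiminfV5` (stmt-Ventures-23912).  Frame bookkeeping (census-free, standard axioms) over '…TextureBuildLayerDescent'
(`exists_local_stacking_descent`), verbatim in the style of `slabPropagation` ('…LayerPropagationFrame').  No cover is built; F-C1 not moved.

* **`descentPropagation`** — `x` a unit packing; a chart `stacking L b σ` carrying every ball within `r` of `b` and complete within `r` of `b`
  (`N 0 + 1 ≤ r`); per-level radii `2 ≤ N m ≤ R`; close-packed shells asked only at the balls whose chart coordinates `v = L⁻¹(x c − b)` satisfy
  `|v₃ + m√(2/3)| ≤ 1` and `‖v‖ ≤ m + R + 2` for some `m ≤ K + 1` (a slab-cone on the wall side of the chart, levels `0 … K+1` below `b`).  Conclusion: a Hägg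
  word `s` (frame `L`, origin `b` unchanged) such that for every depth `M ≤ K + 1`, UNLESS some level `1 ≤ m ≤ M` is FCC-type (`s(−m−1) = s(−m)`) and carries a
  ball `x c = L(barlowPos 1 √(2/3) s (−m) i j) + b`, `|i| + |j| ≤ N m + 1`, whose contact shell is HCP-arranged (an INCLINED COHERENT TWIN through that ball),
  every site `L(barlowPos 1 √(2/3) s (−M) i j) + b` with `|i| + |j| ≤ N M` is a ball of `x`.
-/

noncomputable section

namespace Summit.Ventures.Crystal3D.Theorems

open Literature.Geometry.DiscreteGeometry Literature.MathematicalPhysics.StatisticalMechanics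
open RealInnerProductSpace Summit.Ventures.Crystal3D.L2B Summit.Ventures.Crystal3D.Theorems.LocalStacking
open Summit.Ventures.Crystal3D.Cruxes.TextureLiminf.TexShadow (stacking)

variable {N₀ : ℕ} {x : Fin N₀ → EuclideanSpace ℝ (Fin 3)}

/-- **THE DESCENT FOR A LABELLED PACKING.**  See the module docstring. -/
theorem descentPropagation (hx : IsUnitPacking x) {L : EuclideanSpace ℝ (Fin 3) ≃ₗᵢ[ℝ] EuclideanSpace ℝ (Fin 3)}
    {b : EuclideanSpace ℝ (Fin 3)} {σ : ℤ → ℤ} (hσ : IsHaggSeq σ)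
    (N : ℕ → ℤ) (K : ℕ) (R : ℤ) (hN2 : ∀ m, m ≤ K + 1 → 2 ≤ N m) (hNR : ∀ m, N m ≤ R)
    {r : ℝ} (hnr : ((N 0 : ℤ) : ℝ) + 1 ≤ r)
    (hcarry : ∀ c, dist (x c) b ≤ r → x c ∈ stacking L b σ)
    (hcomp : ∀ w ∈ stacking L b σ, dist w b ≤ r → w ∈ Set.range x)
    (hcp : ∀ c : Fin N₀, ∀ m : ℕ, m ≤ K + 1 → |(L.symm (x c - b)) 2 + m * Real.sqrt (2 / 3)| ≤ 1 →
      ‖L.symm (x c - b)‖ ≤ m + R + 2 → IsClosePackedShell x c) :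
    ∃ s : ℤ → ℤ, IsHaggSeq s ∧ ∀ M : ℕ, M ≤ K + 1 →
      (¬ ∃ m : ℕ, 1 ≤ m ∧ m ≤ M ∧ s (-(m : ℤ) - 1) = s (-(m : ℤ)) ∧ ∃ i j : ℤ, |i| + |j| ≤ N m + 1 ∧
          ∃ c : Fin N₀, x c = L (barlowPos 1 (Real.sqrt (2 / 3)) s (-(m : ℤ)) i j) + b ∧
            IsArrangedIn (contactShell x c) hcpKissingPattern) →
      ∀ i j : ℤ, |i| + |j| ≤ N M → L (barlowPos 1 (Real.sqrt (2 / 3)) s (-(M : ℤ)) i j) + b ∈ Set.range x := by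
  set V : Set (EuclideanSpace ℝ (Fin 3)) := Set.range fun j => (2 : ℝ) • x j with hVdef
  have hV : IsUnitBallPacking V := isUnitBallPacking_range_two_smul hx
  set W : Set (EuclideanSpace ℝ (Fin 3)) := {y | (2 : ℝ) • b + L y ∈ V} with hWdef
  have hW : IsUnitBallPacking W := hV.preimage ((2 : ℝ) • b) L
  have memW : ∀ y, y ∈ W ↔ ∃ c, (2 : ℝ) • x c = (2 : ℝ) • b + L y := fun y => by
    simp only [hWdef, hVdef, Set.mem_setOf_eq, Set.mem_range]
  have halfW : ∀ {y : EuclideanSpace ℝ (Fin 3)} {c : Fin N₀}, (2 : ℝ) • x c = (2 : ℝ) • b + L y →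
      x c - b = L ((2 : ℝ)⁻¹ • y) := by
    intro y c h
    have h2 : (2 : ℝ) • (x c - b) = L y := by rw [smul_sub, h]; abel
    rw [map_smul, ← h2, smul_smul]; norm_num
  have halfW' : ∀ {y : EuclideanSpace ℝ (Fin 3)} {c : Fin N₀}, (2 : ℝ) • x c = (2 : ℝ) • b + L y →
      L.symm (x c - b) = (2 : ℝ)⁻¹ • y := by
    intro y c h; rw [halfW h, LinearIsometryEquiv.symm_apply_apply]
  have distW : ∀ {y : EuclideanSpace ℝ (Fin 3)} {c : Fin N₀}, (2 : ℝ) • x c = (2 : ℝ) • b + L y → dist (x c) b = ‖y‖ / 2 := by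
    intro y c h
    rw [dist_eq_norm, halfW h, LinearIsometryEquiv.norm_map, norm_smul, Real.norm_of_nonneg (by norm_num)]; ring
  -- the site with doubled coordinates `y` is the ball `c`: then `x c = L (½ y) + b`
  have ballW : ∀ {y : EuclideanSpace ℝ (Fin 3)} {c : Fin N₀}, (2 : ℝ) • x c = (2 : ℝ) • b + L y →
      ∀ (s : ℤ → ℤ) (k i j : ℤ), y = barlowPos 2 layerSpacing s k i j → x c = L (barlowPos 1 (Real.sqrt (2 / 3)) s k i j) + b := by
    intro y c h s k i j hy
    have h1 := halfW h
    rw [hy, barlowPos_two_eq_two_smul, smul_smul, inv_mul_cancel₀ (two_ne_zero' ℝ), one_smul] at h1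
    rw [← h1]; abel
  -- (A) sites of the chart within `r` are `W`-points
  have siteW : ∀ k i j : ℤ, ‖barlowPos 1 (Real.sqrt (2 / 3)) σ k i j‖ ≤ r → barlowPos 2 layerSpacing σ k i j ∈ W := by
    intro k i j hq
    set q := barlowPos 1 (Real.sqrt (2 / 3)) σ k i j with hqdef
    have hmem : L q + b ∈ stacking L b σ := ⟨q, ⟨k, i, j, rfl⟩, rfl⟩
    have hd : dist (L q + b) b ≤ r := by rwa [dist_eq_norm, add_sub_cancel_right, LinearIsometryEquiv.norm_map]
    obtain ⟨c, hc⟩ := hcomp _ hmem hd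
    refine (memW _).2 ⟨c, ?_⟩
    rw [hc, barlowPos_two_eq_two_smul, map_smul, smul_add]
    abel
  -- (B) `W`-points within `2r` are doubled sites of the chart
  have pointB : ∀ y ∈ W, ‖y‖ ≤ 2 * r → y ∈ barlowStacking 2 layerSpacing σ := by
    intro y hy hyn
    obtain ⟨c, hc⟩ := (memW y).1 hy
    have hd : dist (x c) b ≤ r := by rw [distW hc]; linarith
    obtain ⟨q, hq, hcq⟩ := hcarry c hd
    have hyq : y = (2 : ℝ) • q := by
      have hcq' : L q + b = x c := hcq
      have h1 : x c - b = L q := by rw [← hcq', add_sub_cancel_right]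
      rw [halfW hc] at h1
      have h2 := L.injective h1
      rw [← h2, smul_smul]; norm_num
    rw [hyq]
    exact (Summit.Ventures.Crystal3D.mem_barlowStacking_one_iff σ q).1 hq
  -- the base layer datum of radius `N 0`
  have hσ0 : ((σ 0 : ℤ) : ℝ) = 1 ∨ ((σ 0 : ℤ) : ℝ) = -1 := by rcases hσ 0 with h | h <;> simp [h]
  have hσ1 : (-((σ (-1) : ℤ) : ℝ)) = 1 ∨ (-((σ (-1) : ℤ) : ℝ)) = -1 := by rcases hσ (-1) with h | h <;> simp [h]
  have hLD : LayerDisc W 0 ((σ 0 : ℤ) : ℝ) (-((σ (-1) : ℤ) : ℝ)) (N 0) := by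
    intro i j hij
    have hij' : ((|i| + |j| : ℤ) : ℝ) ≤ N 0 := by exact_mod_cast hij
    have hnorm2 : ‖barlowPos 2 layerSpacing σ 0 i j‖ ≤ 2 * (N 0 : ℤ) := by
      rw [barlowPos_two_zero_eq_latPt]; linarith [norm_latPt_le i j]
    have hnorm1 : ‖barlowPos 1 (Real.sqrt (2 / 3)) σ 0 i j‖ ≤ r := by rw [norm_barlowPos_one]; linarith
    rw [zero_add, ← barlowPos_two_zero_eq_latPt σ]
    refine ⟨siteW 0 i j hnorm1, ?_⟩
    have hshell0 := kissingShell_barlowStacking_eq_layerShell hσ 0 i j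
    rw [show (0 : ℤ) - 1 = -1 from by norm_num] at hshell0
    rw [← hshell0]
    ext y
    simp only [mem_kissingShell_iff]
    constructor
    · rintro ⟨hyW, hy2⟩
      refine ⟨pointB _ hyW ?_, hy2⟩
      calc ‖barlowPos 2 layerSpacing σ 0 i j + y‖ ≤ ‖barlowPos 2 layerSpacing σ 0 i j‖ + ‖y‖ := norm_add_le _ _
        _ ≤ 2 * (N 0 : ℤ) + 2 := by rw [hy2]; linarith
        _ ≤ 2 * r := by linarith
    · rintro ⟨hyB, hy2⟩
      refine ⟨?_, hy2⟩
      obtain ⟨k', i', j', hk'⟩ := hyB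
      have hnorm' : ‖barlowPos 1 (Real.sqrt (2 / 3)) σ k' i' j'‖ ≤ r := by
        rw [norm_barlowPos_one, ← hk']
        calc ‖barlowPos 2 layerSpacing σ 0 i j + y‖ / 2 ≤ (‖barlowPos 2 layerSpacing σ 0 i j‖ + ‖y‖) / 2 := by
              gcongr; exact norm_add_le _ _
          _ ≤ (2 * (N 0 : ℤ) + 2) / 2 := by rw [hy2]; linarith
          _ ≤ r := by linarith
      rw [hk']
      exact siteW k' i' j' hnorm'
  -- the slab-cone hypothesis in the frame
  have hcpW : ∀ u ∈ W, ∀ m : ℕ, m ≤ K + 1 → |u 2 + m * layerSpacing| ≤ 2 → ‖u‖ ≤ 2 * m + 2 * R + 4 →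
      IsArrangedIn (kissingShell W u) fccKissingPattern ∨ IsArrangedIn (kissingShell W u) hcpKissingPattern := by
    intro u hu m hm hu2 hun
    obtain ⟨c, hc⟩ := (memW u).1 hu
    have hshell : kissingShell W u = L ⁻¹' kissingShell V ((2 : ℝ) • x c) := by
      rw [hWdef, kissingShell_moved, ← hc]
    have hcp' : IsClosePackedShell x c := by
      refine hcp c m hm ?_ ?_
      · rw [halfW' hc, PiLp.smul_apply, smul_eq_mul]
        have e : (2 : ℝ)⁻¹ * u 2 + m * Real.sqrt (2 / 3) = (2 : ℝ)⁻¹ * (u 2 + m * layerSpacing) := by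
          rw [layerSpacing]; ring
        rw [e, abs_mul, abs_of_pos (by norm_num : (0 : ℝ) < 2⁻¹)]
        linarith
      · rw [halfW' hc, norm_smul, Real.norm_of_nonneg (by norm_num)]
        have hR' : ((R : ℤ) : ℝ) = (R : ℝ) := rfl
        linarith
    rw [hshell, hVdef, kissingShell_range_two_smul]
    exact hcp'.imp (fun h => h.preimage L) (fun h => h.preimage L)
  -- run the descent and undo the frame
  obtain ⟨s, hs, hdesc⟩ := exists_local_stacking_descent hW hσ0 hσ1 N K R hN2 hNR hLD hcpW
  refine ⟨s, hs, fun M hM hnow i j hij => ?_⟩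
  have hnow' : ¬ ∃ m : ℕ, 1 ≤ m ∧ m ≤ M ∧ s (-(m : ℤ) - 1) = s (-(m : ℤ)) ∧ ∃ i j : ℤ, |i| + |j| ≤ N m + 1 ∧
      barlowPos 2 layerSpacing s (-(m : ℤ)) i j ∈ W ∧
      IsArrangedIn (kissingShell W (barlowPos 2 layerSpacing s (-(m : ℤ)) i j)) hcpKissingPattern := by
    rintro ⟨m, hm1, hmM, htyp, i', j', hij', hmem, harr⟩
    obtain ⟨c, hc⟩ := (memW _).1 hmem
    refine hnow ⟨m, hm1, hmM, htyp, i', j', hij', c, ballW hc s _ _ _ rfl, ?_⟩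
    have hshell : kissingShell W (barlowPos 2 layerSpacing s (-(m : ℤ)) i' j') = L ⁻¹' kissingShell V ((2 : ℝ) • x c) := by
      rw [hWdef, kissingShell_moved, ← hc]
    rw [hshell, hVdef, kissingShell_range_two_smul] at harr
    have h := harr.preimage L.symm
    have e : L.symm ⁻¹' (L ⁻¹' contactShell x c) = contactShell x c := by
      ext z; simp
    rwa [e] at h
  obtain ⟨c, hc⟩ := (memW _).1 (hdesc M hM hnow' i j hij)
  exact ⟨c, ballW hc s _ _ _ rfl⟩

end Summit.Ventures.Crystal3D.Theorems

end
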